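import Summits.PneNP.PneNP.Theses.FineGrained
import Literature.Computability.FineGrained.SatAlgorithmsProofs
import Literature.Computability.Complexity.CookBridges

/-!
# Route FineGrained — `Assembly2` (stmt-PneNP-0288): ETH implies `P ≠ NP`

`Assembly2 := FinegrainedEth → PneNP`, where `FinegrainedEth` is verbatim the tree's `ETH`
(`∃ δ > 0, ¬ KSATInExpTime 3 δ`). The Literature fact `P_ne_NP_of_eth` (ETH ⇒ `Classes.P ≠ NP`,
Impagliazzo–Paturi 2001 §1; Fomin–Kratsch 2010 p. 174) is DISCHARGED in the tree
(`P_ne_NP_of_eth_holds`, `SatAlgorithmsProofs.lean`), and `pneNP_shape_of_P_ne_NP` moves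
`Classes.P ≠ NP` onto the summit's Wave0 classes.
-/

set_option linter.dupNamespace false -- `Summit.PneNP.PneNP.…`: summit = sub-problem name (D-0017 single-conjunct layout)

namespace Summit.PneNP.PneNP.Theorems

open Literature.Computability.Complexity Literature.Computability.FineGrained

/-- **Assembly item `Assembly2` of route FineGrained (stmt-PneNP-0288)**: ETH (`FinegrainedEth`)
implies `PneNP`, by the proved fact `P_ne_NP_of_eth_holds` and the class bridge
`pneNP_shape_of_P_ne_NP`. [cite: ImpagliazzoPaturi2001, §1] [cite: FominKratsch2010, p. 174] -/
theorem fineGrained_assembly2_proof : Summit.PneNP.PneNP.Theses.FineGrained.Assembly2 := by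
  unfold Summit.PneNP.PneNP.Theses.FineGrained.Assembly2
    Summit.PneNP.PneNP.Theses.FineGrained.FinegrainedEth
  exact fun hE => pneNP_shape_of_P_ne_NP (P_ne_NP_of_eth_holds hE)

end Summit.PneNP.PneNP.Theorems
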